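import Summits.BirchSwinnertonDyer.BirchSwinnertonDyer.Theorems.GenusKolyvaginAtTwoGenusPrimitiveSupplyAtTwoLoweringImageNoTwoTorsion
import HarnessLib

/-!
# `H¹(K(E[2])/K, E[2]) = 0` for EVERY elliptic curve (no image hypothesis): Gross's Prop. 9.1 at
# level `2` unconditionally (Lawson–Wuthrich 2016, §5: «the cohomology group `H¹(G; E[2])` always vanishes»)

Lead seat `bsd-line-gk2-p1` g11 (route `GenusKolyvaginAtTwo`, crux stmt-BirchSwinnertonDyer-22136). THEOREMS ONLY
(no definition, no named fact, no `sorry`); helper `--supports stmt-BirchSwinnertonDyer-22136`; no item is closed;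
BSD is not proved by any of this.

WHY. The tree has the level-`2` injectivity `H¹(K, E[2]) ↪ Hom(Γ_{K(E[2])}, E[2])` in two cases: from a
fixed-point-free element of `Γ_K` on `E[2]` (`KolyvaginImageTwo.eq_zero_of_h1Eval_eq_zero_two`, any field; image
`C₃`/`S₃`) and, over `ℚ`, from `E(ℚ)[2] = 0` (`GenusKolyLowering.h1_restriction_injective_two_rat'`). Lawson–Wuthrich
(2016, §5) observe that `H¹(G, E[2]) = 0` for EVERY subgroup `G ≤ GL₂(𝔽₂)`: the remaining images (`1` and the three
subgroups of order `2`, i.e. a `Γ_K`-fixed non-zero point of `E[2]`) have `H¹(⟨τ⟩, 𝔽₂²) = ker(1 + τ)/im(τ − 1) = 0` for a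
transvection `τ`. This file proves the unconditional statement in the machine's vocabulary, over ANY field with
`#E[2] = 4`:

* `KolyvaginImageTwo.eq_zero_of_h1Eval_eq_zero_two_of_fixed` — the complementary case: if some non-zero `P₀ ∈ E[2]`
  is fixed by all of `Γ_K`, a class `x ∈ H¹(K, E[2])` with `[x, ρ] = 0` for all `ρ ∈ Γ_{K(E[2])}` is `0`
  (the image of `Γ_K` is `1` or `{1, τ}` with `τ` the transvection of axis `P₀`; the cocycle value `w = c(t)` at a
  lift `t` of `τ` satisfies `τ w = w`, so `w ∈ {0, P₀} = im(τ − 1)` and `c` is a coboundary);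
* **`KolyvaginImageTwo.eq_zero_of_h1Eval_eq_zero_two_any`** — for EVERY elliptic curve over every field with
  `#E[2] = 4`: `(∀ ρ ∈ Γ_{K(E[2])}, [x, ρ] = 0) → x = 0`, i.e. `H¹(K(E[2])/K, E[2]) = 0`
  (dichotomy: a common fixed point, or a fixed-point-free element by `GenusKolyLowering.exists_smul_fixedPointFree`);
  `…_two_any_rat` — over `ℚ` with `#E[2] = 4` supplied by the tree.

Contrast: at level `2^k`, `k ≥ 2`, with surjective `ρ̄_{E,2^k}` the group `H¹(K(E[2^k])/K, E[2^k])` is NOT zero (order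
`≤ 2`: `LawsonWuthrich2016.natCard_subgroupResKer_two_pow_le_two`, Literature, this seat). «beyond-print theorem»: no
(Lawson–Wuthrich 2016 §5). References: [LawsonWuthrich2016] §5; [GrossLMS1991] §9 Prop. 9.1; [SerreGaloisCohomology1997] I.§5.
-/

-- single-conjunct summit: `Summit.BirchSwinnertonDyer.BirchSwinnertonDyer.…` repeats the name by design
set_option linter.dupNamespace false
set_option autoImplicit false

noncomputable section

open scoped Classical

namespace Summit.BirchSwinnertonDyer.BirchSwinnertonDyer.Theorems.KolyvaginImageTwo

open WeierstrassCurve Field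
open Literature.NumberTheory.EllipticCurves Literature.NumberTheory.GaloisRepresentations
open Summit.BirchSwinnertonDyer.BirchSwinnertonDyer.Theorems.GenusKolyLowering (exists_smul_fixedPointFree)

universe u

variable {K : Type u} [Field K] (W : WeierstrassCurve K)

/-- **The complementary case: a `Γ_K`-fixed non-zero point of `E[2]`.** If `#E[2] = 4` and some non-zero
`P₀ ∈ E[2]` is fixed by every element of `Γ_K` (image of `ρ̄_{E,2}` of order `≤ 2`), then a class `x ∈ H¹(K, E[2])`
with `[x, ρ] = 0` for all `ρ ∈ Γ_{K(E[2])}` vanishes: `H¹(⟨τ⟩, 𝔽₂²) = ker(1 + τ)/im(τ − 1) = 0` for a transvection `τ`.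
[cite: LawsonWuthrich2016, §5 (H¹(⟨h⟩, E[2]) = 0 for h of order 2)] [cite: GrossLMS1991, §9 Prop. 9.1] -/
theorem eq_zero_of_h1Eval_eq_zero_two_of_fixed (hcard : Nat.card (geomTorsion W ((2 : ℕ) : ℤ)) = 4)
    {P₀ : geomTorsion W ((2 : ℕ) : ℤ)} (hP₀ : P₀ ≠ 0) (hfix : ∀ σ : absoluteGaloisGroup K, σ • P₀ = P₀)
    {x : galH1Torsion W ((2 : ℕ) : ℤ)}
    (hx : ∀ ρ ∈ torsionFixing W ((2 : ℕ) : ℤ), h1Eval W ((2 : ℕ) : ℤ) x ρ = 0) : x = 0 := by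
  haveI : Finite (geomTorsion W ((2 : ℕ) : ℤ)) := Nat.finite_of_card_ne_zero (by rw [hcard]; norm_num)
  have h2 : ∀ t : geomTorsion W ((2 : ℕ) : ℤ), t + t = 0 := fun t ↦ by
    have := AddSubgroup.torsionBy.nsmul t
    rwa [two_nsmul] at this
  have hneg : ∀ t : geomTorsion W ((2 : ℕ) : ℤ), -t = t := fun t ↦ neg_eq_of_add_eq_zero_left (h2 t)
  -- the chosen cocycle `c` of `x` vanishes on `Γ_{K(E[2])}`
  set c := reprCocycle W ((2 : ℕ) : ℤ) x with hc
  have hc0 : ∀ ρ ∈ torsionFixing W ((2 : ℕ) : ℤ), c.1 ρ = 0 := fun ρ hρ ↦ hx ρ hρ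
  have hcocycle : ∀ g h : absoluteGaloisGroup K, c.1 (g * h) = c.1 g + g • c.1 h := fun g h ↦ by
    have := c.2 g h
    rwa [discreteTopRep_ρ_apply] at this
  -- it suffices to produce `v` with `c = ∂v`
  suffices hv : ∃ v : geomTorsion W ((2 : ℕ) : ℤ), ∀ g, c.1 g = g • v - v by
    obtain ⟨v, hv⟩ := hv
    rw [← oneCocycleClass_reprCocycle W ((2 : ℕ) : ℤ) x, oneCocycleClass_eq_zero_iff]
    exact ⟨v, fun g ↦ by rw [discreteTopRep_ρ_apply]; exact hv g⟩
  by_cases htriv : ∀ (g : absoluteGaloisGroup K) (P : geomTorsion W ((2 : ℕ) : ℤ)), g • P = P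
  · -- image trivial: `Γ_{K(E[2])} = Γ_K`, `c = 0`
    refine ⟨0, fun g ↦ ?_⟩
    rw [smul_zero, sub_zero]
    exact hc0 g ((mem_torsionFixing_iff W _).2 (htriv g))
  · -- image `{1, τ}`: a lift `t` of the transvection `τ` with axis `P₀`
    push Not at htriv
    obtain ⟨t, Q₁, hQ₁⟩ := htriv
    have hQ₁0 : Q₁ ≠ 0 := fun h ↦ hQ₁ (by rw [h, smul_zero])
    have hQ₁P : Q₁ ≠ P₀ := fun h ↦ hQ₁ (by rw [h, hfix])
    -- `t Q₁ = Q₁ + P₀` (the only value left), hence `t² = 1` on `E[2]`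
    have htQ₁ : t • Q₁ = P₀ + Q₁ := by
      rcases mem_four h2 hcard hP₀ hQ₁0 hQ₁P (t • Q₁) with h | h | h | h
      · exact absurd ((smul_eq_zero_iff_eq t).1 h) hQ₁0
      · exact absurd (smul_left_cancel t (h.trans (hfix t).symm)) hQ₁P
      · exact absurd h hQ₁
      · exact h
    -- every `g` acts on `E[2]` as `1` or as `t`
    have hdich : ∀ g : absoluteGaloisGroup K,
        g ∈ torsionFixing W ((2 : ℕ) : ℤ) ∨ t⁻¹ * g ∈ torsionFixing W ((2 : ℕ) : ℤ) := by
      intro g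
      have key : ∀ g' : absoluteGaloisGroup K, g' • Q₁ = Q₁ → g' ∈ torsionFixing W ((2 : ℕ) : ℤ) := by
        intro g' hg'
        refine (mem_torsionFixing_iff W _).2 fun P ↦ ?_
        rcases mem_four h2 hcard hP₀ hQ₁0 hQ₁P P with h | h | h | h
        · rw [h, smul_zero]
        · rw [h, hfix]
        · rw [h, hg']
        · rw [h, smul_add, hfix, hg']
      rcases mem_four h2 hcard hP₀ hQ₁0 hQ₁P (g • Q₁) with h | h | h | h
      · exact absurd ((smul_eq_zero_iff_eq g).1 h) hQ₁0
      · exact absurd (smul_left_cancel g (h.trans (hfix g).symm)) hQ₁P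
      · exact Or.inl (key g h)
      · right
        apply key
        rw [mul_smul, h, ← htQ₁, inv_smul_smul]
    have htt : t * t ∈ torsionFixing W ((2 : ℕ) : ℤ) := by
      rcases hdich (t * t) with h | h
      · exact h
      · exfalso
        rw [← mul_assoc, inv_mul_cancel, one_mul] at h
        exact hQ₁ (smul_eq_of_mem_torsionFixing W _ h Q₁)
    -- `w = c(t)` is fixed by `t`, hence `w ∈ {0, P₀}`
    have hw : t • c.1 t = c.1 t := by
      have h := hc0 _ htt
      rw [hcocycle] at h
      have h' := eq_neg_of_add_eq_zero_right h
      rwa [hneg] at h'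
    have hw' : c.1 t = 0 ∨ c.1 t = P₀ := by
      rcases mem_four h2 hcard hP₀ hQ₁0 hQ₁P (c.1 t) with h | h | h | h
      · exact Or.inl h
      · exact Or.inr h
      · exact absurd (hw.trans h) (by rw [h]; exact hQ₁)
      · exfalso
        rw [h, smul_add, hfix, htQ₁, ← add_assoc, h2, zero_add] at hw
        exact hP₀ ((add_eq_right).1 hw.symm)
    -- conclude with `v = 0` or `v = Q₁`
    have finish : ∀ v : geomTorsion W ((2 : ℕ) : ℤ), t • v - v = c.1 t →
        ∀ g, c.1 g = g • v - v := by
      intro v hvt g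
      have hvn : ∀ n ∈ torsionFixing W ((2 : ℕ) : ℤ), c.1 n = n • v - v := fun n hn ↦ by
        rw [hc0 n hn, smul_eq_of_mem_torsionFixing W _ hn, sub_self]
      rcases hdich g with hg | hg
      · exact hvn g hg
      · have hg' : c.1 g = c.1 (t * (t⁻¹ * g)) := by rw [mul_inv_cancel_left]
        rw [hg', hcocycle, hvn _ hg, ← hvt, smul_sub, ← mul_smul, mul_inv_cancel_left]
        abel
    rcases hw' with h0 | h0
    · exact ⟨0, finish 0 (by rw [smul_zero, sub_zero, h0])⟩
    · exact ⟨Q₁, finish Q₁ (by rw [htQ₁, add_sub_cancel_right, h0])⟩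

/-- **`H¹(K(E[2])/K, E[2]) = 0` for EVERY elliptic curve** over every field with `#E[2] = 4` (Lawson–Wuthrich
2016, §5: `H¹(G, E[2]) = 0` for all `G ≤ GL₂(𝔽₂)`): a class `x ∈ H¹(K, E[2])` with `[x, ρ] = 0` for all
`ρ ∈ Γ_{K(E[2])}` is `0`. Dichotomy: either some non-zero point of `E[2]` is `Γ_K`-fixed
(`eq_zero_of_h1Eval_eq_zero_two_of_fixed`), or some element acts without non-zero fixed points
(`GenusKolyLowering.exists_smul_fixedPointFree`, then `eq_zero_of_h1Eval_eq_zero_two`).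
[cite: LawsonWuthrich2016, §5] [cite: GrossLMS1991, §9 Prop. 9.1] -/
theorem eq_zero_of_h1Eval_eq_zero_two_any (hcard : Nat.card (geomTorsion W ((2 : ℕ) : ℤ)) = 4)
    {x : galH1Torsion W ((2 : ℕ) : ℤ)}
    (hx : ∀ ρ ∈ torsionFixing W ((2 : ℕ) : ℤ), h1Eval W ((2 : ℕ) : ℤ) x ρ = 0) : x = 0 := by
  by_cases hnt : ∀ P : geomTorsion W ((2 : ℕ) : ℤ), (∀ σ : absoluteGaloisGroup K, σ • P = P) → P = 0
  · have h2 : ∀ t : geomTorsion W ((2 : ℕ) : ℤ), t + t = 0 := fun t ↦ by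
      have := AddSubgroup.torsionBy.nsmul t
      rwa [two_nsmul] at this
    obtain ⟨z, hz⟩ := exists_smul_fixedPointFree h2 hcard hnt
    exact eq_zero_of_h1Eval_eq_zero_two W hcard hz hx
  · push Not at hnt
    obtain ⟨P₀, hfix, hP₀⟩ := hnt
    exact eq_zero_of_h1Eval_eq_zero_two_of_fixed W hcard hP₀ hfix hx

/-- **`H¹(ℚ(E[2])/ℚ, E[2]) = 0` for every elliptic curve over `ℚ`** (`#E[2] = 4` from the tree's
`natCard_geomTorsion_two_rat`). [cite: LawsonWuthrich2016, §5] [cite: GrossLMS1991, §9 Prop. 9.1] -/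
theorem eq_zero_of_h1Eval_eq_zero_two_any_rat (W : WeierstrassCurve ℚ) [W.IsElliptic]
    {x : galH1Torsion W ((2 : ℕ) : ℤ)}
    (hx : ∀ ρ ∈ torsionFixing W ((2 : ℕ) : ℤ), h1Eval W ((2 : ℕ) : ℤ) x ρ = 0) : x = 0 :=
  eq_zero_of_h1Eval_eq_zero_two_any W (GenusKolyTwistingPrime.natCard_geomTorsion_two_rat W) hx

/-- **`H¹(K(E[2])/K, E[2]) = 0` for every elliptic curve `E/ℚ` over every number field `K`** — the
unconditional form of the tree's `h1_restriction_injective_two` (which assumed `ρ̄_{E,2}` onto and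
`[K:ℚ] = 2`): if `[x, ρ] = 0` for all `ρ ∈ Γ_{K(E[2])}` then `x = 0` (`#E(K̄)[2] = 4` from
`natCard_geomTorsion_two`). [cite: LawsonWuthrich2016, §5] [cite: GrossLMS1991, §9 Prop. 9.1] -/
theorem eq_zero_of_h1Eval_eq_zero_two_any_baseChange (W : WeierstrassCurve ℚ) [W.IsElliptic]
    (K : Type) [Field K] [NumberField K] {x : galH1Torsion (W.baseChange K) ((2 : ℕ) : ℤ)}
    (hx : ∀ ρ ∈ torsionFixing (W.baseChange K) ((2 : ℕ) : ℤ),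
      h1Eval (W.baseChange K) ((2 : ℕ) : ℤ) x ρ = 0) : x = 0 :=
  eq_zero_of_h1Eval_eq_zero_two_any (W.baseChange K) (natCard_geomTorsion_two W K) hx

end Summit.BirchSwinnertonDyer.BirchSwinnertonDyer.Theorems.KolyvaginImageTwo

end
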